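import Literature.RingTheory.FormalGroups.UniversalFormalOModuleLawTruncation
import Literature.RingTheory.FormalGroups.DrinfeldCocycleLift
import Mathlib.RingTheory.DiscreteValuationRing.Basic
import Mathlib.FieldTheory.Finite.Basic
import Mathlib.Algebra.Polynomial.Roots
import HarnessLib

/-!
# The universal formal `𝒪`-module law, IV: over the integers of a local field — the Lubin–Tate hypotheses, and the
# degree-`m` direction of `F_S` generates Drinfeld's cocycles ([Drinfeld 1974] §1 Prop. 1.4; [Hazewinkel 1978] §21.4)

Topic `Literature/RingTheory/FormalGroups`; namespace `Literature.RingTheory.FormalGroups.UnivOModule`.  One plumbing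
definition (`actDir`, a choice of `(a − a^m)/π`) + fully proved theorems; no named fact, no instance, no notation, no `sorry`.
Sequel of `UniversalFormalOModuleLawTruncation.lean`; cell `hodgecm-mathlib`, P6 «MOD programme» sub-line P6d, `stub_L4B3cO`.

Let `𝒪` be a discrete valuation ring with uniformizer `ϖ` and FINITE residue field `k` of characteristic `p`, `q = #k`.
* §1 `isLTRing_of_isDiscreteValuationRing` — `(𝒪, ϖ, q)` satisfies ★ `IsLTRing ϖ q` (and `2 ≤ q`): the universal law
  `univLaw` of parts I–III is available.
* §2 `exists_isUnit_pow_sub_of_not_isQPow` — if `m = p^j` is NOT a power of `q` then `u^m − u` is a unit for some `u ∈ 𝒪`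
  (the map `x ↦ x^{p^j}` is not the identity of `k`: a nonzero polynomial of degree `< q` cannot vanish on `k`).
* §3 **`exists_eq_smul_direction`** — DRINFELD'S KEY LEMMA read against the universal law: every Drinfeld cocycle `(c, δ)`
  of degree `m ≥ 2` over any `𝒪`-module `N` is `d • (−d_m, e_m)` for a unique direction attached to the variable `S_m` of
  `F_S` (`d_m = dirCoeff`, `e_m = actDir`: `(ν(m), a − a^m)` for `m ∉ q^ℕ`, `(p/π, (a − a^m)/π)` for `m ∈ q^ℕ`), using ★
  `IsDrinfeldCocycle.exists_eq_standard_of_isUnit_lazardNu` ∕ `…_of_isUnit_pow_sub` (easy cases) and ★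
  `IsDrinfeldCocycle.eq_zero_of_apply_eq_zero` (hard case `m = q^i`).

## References
* V. G. Drinfeld, *Elliptic modules*, Math. USSR-Sb. 23 (1974), §1 Prop. 1.4 and its proof. [Drinfeld1974]
* M. Hazewinkel, *Formal Groups and Applications* (1978), §21.4. [Hazewinkel1978]
-/

noncomputable section

open scoped Classical

namespace Literature.RingTheory.FormalGroups

namespace UnivOModule

open MvPowerSeries Literature.NumberTheory.GaloisRepresentations.LubinTate IsLocalRing

universe u v

variable {𝒪 : Type u} [CommRing 𝒪]

/-! ## §1 The integers of a local field satisfy the Lubin–Tate hypotheses -/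

section DVR

variable [IsDomain 𝒪] [IsDiscreteValuationRing 𝒪] [Finite (ResidueField 𝒪)]

/-- **A DVR with finite residue field of characteristic `p`, a uniformizer `ϖ`, and `q = #k` satisfy `IsLTRing ϖ q`**:
`ϖ` is a non-zero-divisor, `1 − ϖ^m` are units, `q = p^r` with `p ∈ (ϖ)`, `a^q ≡ a (mod ϖ)`.
[cite: CasselsFrohlichANT1967, Ch. VI §3.5 Remark 2] [cite: Drinfeld1974, §1] -/
theorem isLTRing_of_isDiscreteValuationRing (p : ℕ) [Fact p.Prime] [CharP (ResidueField 𝒪) p] {ϖ : 𝒪} (hϖ : Irreducible ϖ) :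
    IsLTRing ϖ (Nat.card (ResidueField 𝒪)) ∧ 2 ≤ Nat.card (ResidueField 𝒪) := by
  letI : Fintype (ResidueField 𝒪) := Fintype.ofFinite _
  have hmax : maximalIdeal 𝒪 = Ideal.span {ϖ} := (IsDiscreteValuationRing.irreducible_iff_uniformizer ϖ).1 hϖ
  obtain ⟨n, hpn, hcard⟩ := FiniteField.card (ResidueField 𝒪) p
  have hq : Nat.card (ResidueField 𝒪) = p ^ (n : ℕ) := by rw [Nat.card_eq_fintype_card, hcard]
  have hmem : ∀ x : 𝒪, residue 𝒪 x = 0 → ϖ ∣ x := fun x hx => by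
    rw [residue_eq_zero_iff, hmax, Ideal.mem_span_singleton] at hx; exact hx
  refine ⟨⟨fun x hx => ?_, fun m hm => ?_, ⟨p, n, hpn, hq, ?_⟩, fun a => ?_⟩, ?_⟩
  · exact (mul_eq_zero.mp hx).resolve_left hϖ.ne_zero
  · apply isUnit_one_sub_self_of_mem_nonunits
    rw [← mem_maximalIdeal]
    exact Ideal.pow_mem_of_mem _ (hmax ▸ Ideal.mem_span_singleton_self ϖ) _ hm
  · rw [← hmax, ← residue_eq_zero_iff, map_natCast]
    exact CharP.cast_eq_zero _ p
  · apply hmem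
    rw [map_sub, map_pow, hq, ← hcard, FiniteField.pow_card, sub_self]
  · rw [hq]
    calc 2 ≤ p := hpn.two_le
      _ = p ^ 1 := (pow_one p).symm
      _ ≤ p ^ (n : ℕ) := Nat.pow_le_pow_right hpn.pos n.pos

/-! ## §2 The degree `m = p^j ∉ q^ℕ`: a unit `u^m − u` -/

omit [IsDomain 𝒪] [IsDiscreteValuationRing 𝒪] [Finite (ResidueField 𝒪)] in
/-- If `x^{p^j} = x` for all `x` in a finite field `k` of characteristic `p` with `#k = p^n`, then `n ∣ j`
(reduce `j` mod `n`; a nonzero polynomial `X^{p^d} − X`, `d < n`, cannot vanish on `k`). [cite: Drinfeld1974, §1 Prop. 1.4 (proof)] -/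
theorem dvd_of_forall_pow_prime_pow_eq (p : ℕ) [hp : Fact p.Prime] (k : Type*) [Field k] [Fintype k] [CharP k p] {n : ℕ}
    (hn : 0 < n)
    (hcard : Fintype.card k = p ^ n) {j : ℕ} (h : ∀ x : k, x ^ p ^ j = x) : n ∣ j := by
  -- reduce to `d = j % n`
  set d := j % n with hd
  have hpow : ∀ x : k, x ^ p ^ d = x := by
    intro x
    have hj : j = n * (j / n) + d := (Nat.div_add_mod j n).symm
    have hx : x ^ p ^ (n * (j / n)) = x := by
      rw [pow_mul, ← hcard]; exact FiniteField.pow_card_pow _ _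
    have := h x
    rwa [hj, pow_add, pow_mul, hx] at this
  by_contra hndvd
  have hd0 : 0 < d := Nat.pos_of_ne_zero (fun h0 => hndvd (Nat.dvd_of_mod_eq_zero h0))
  have hdn : d < n := Nat.mod_lt j hn
  -- the polynomial `X^{p^d} − X` vanishes on `k` but has degree `p^d < #k`
  set P : Polynomial k := Polynomial.X ^ p ^ d - Polynomial.X with hP
  have h1 : 1 < p ^ d := Nat.one_lt_pow hd0.ne' hp.out.one_lt
  have hdeg : P.natDegree = p ^ d := by
    rw [hP, Polynomial.natDegree_sub_eq_left_of_natDegree_lt] <;> simp [h1]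
  have hP0 : P ≠ 0 := fun h0 => by
    have := hdeg; rw [h0, Polynomial.natDegree_zero] at this; exact (pow_ne_zero d hp.out.ne_zero) this.symm
  refine hP0 (Polynomial.eq_zero_of_natDegree_lt_card_of_eval_eq_zero P Function.injective_id (fun x => ?_) ?_)
  · simp [hP, hpow]
  · rw [hdeg, hcard]; exact Nat.pow_lt_pow_right hp.out.one_lt hdn

/-- **For `m = p^j` not a power of `q = #k` there is `u ∈ 𝒪` with `u^m − u` a unit** (the easy case (b) of Drinfeld's
classification applies). [cite: Drinfeld1974, §1 Prop. 1.4 (proof)] -/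
theorem exists_isUnit_pow_sub_of_not_isQPow (p : ℕ) [hp : Fact p.Prime] [CharP (ResidueField 𝒪) p] {j : ℕ} (hj : 1 ≤ j)
    (hnot : ¬ IsQPow (Nat.card (ResidueField 𝒪)) (p ^ j)) :
    ∃ u : 𝒪, IsUnit (u ^ p ^ j - u) := by
  letI : Fintype (ResidueField 𝒪) := Fintype.ofFinite _
  obtain ⟨n, hpn, hcard⟩ := FiniteField.card (ResidueField 𝒪) p
  by_contra hall
  simp only [not_exists] at hall
  -- every `x ∈ k` satisfies `x^{p^j} = x`
  have hk : ∀ x : ResidueField 𝒪, x ^ p ^ j = x := by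
    intro x
    obtain ⟨u, rfl⟩ := residue_surjective (R := 𝒪) x
    have hu : residue 𝒪 (u ^ p ^ j - u) = 0 := (residue_eq_zero_iff _).mpr ((mem_maximalIdeal _).mpr (hall u))
    rw [map_sub, map_pow, sub_eq_zero] at hu
    exact hu
  obtain ⟨i, hi⟩ := dvd_of_forall_pow_prime_pow_eq p (ResidueField 𝒪) n.pos hcard hk
  apply hnot
  have hq : Nat.card (ResidueField 𝒪) = p ^ (n : ℕ) := by rw [Nat.card_eq_fintype_card, hcard]
  have hq2 : 2 ≤ p ^ (n : ℕ) := le_trans hpn.two_le (by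
    calc p = p ^ 1 := (pow_one p).symm
      _ ≤ p ^ (n : ℕ) := Nat.pow_le_pow_right hpn.pos n.pos)
  refine ⟨le_trans hp.out.two_le ?_, ?_⟩
  · calc p = p ^ 1 := (pow_one p).symm
      _ ≤ p ^ j := Nat.pow_le_pow_right hp.out.pos hj
  · rw [hq, hi, pow_mul, Nat.log_pow (by omega) i]

end DVR

/-! ## §3 The direction of `S_m` generates Drinfeld's cocycles -/

section Direction

variable (π : 𝒪) (q : ℕ)

/-- The action direction `e_m(a)`: `a − a^m` if `m ∉ q^ℕ`, the element with `π · e_m(a) = a − a^m` if `m ∈ q^ℕ` (a choice; see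
`exists_actDir`). [cite: Hazewinkel1978, §21.4] -/
def actDir (hA : IsLTRing π q) (m : ℕ) (a : 𝒪) : 𝒪 := (exists_actDir (π := π) hA m a).choose

variable {π q}

/-- The defining properties of `actDir`. [cite: Hazewinkel1978, §21.4] -/
theorem actDir_spec (hA : IsLTRing π q) (m : ℕ) (a : 𝒪) :
    (if IsQPow q m then π * actDir π q hA m a = a - a ^ m else actDir π q hA m a = a - a ^ m) ∧
      incl π (MvPolynomial.X m * MvPolynomial.C (actDir π q hA m a)) =
        topCoeff π q m * (MvPolynomial.C (algebraMap 𝒪 _ a) - MvPolynomial.C (algebraMap 𝒪 _ a) ^ m) :=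
  (exists_actDir (π := π) hA m a).choose_spec

/-- `π` is regular under `IsLTRing π q`. [cite: CasselsFrohlichANT1967, Ch. VI §3.5] -/
theorem isRegular_of_isLTRing (hA : IsLTRing π q) : IsRegular π := by
  have hleft : IsLeftRegular π := fun x y hxy => by
    have h : π * (x - y) = 0 := by rw [mul_sub]; exact sub_eq_zero.mpr hxy
    exact sub_eq_zero.mp (hA.eq_zero_of_mul_eq_zero _ h)
  exact ⟨hleft, fun x y hxy => hleft (by simpa [mul_comm] using hxy)⟩

/-- **The direction `(−d_m, e_m)` is a Drinfeld cocycle** (the standard solution attached to the divisor `w = 1`, resp.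
`w = π`, up to the sign of `d`). [cite: Drinfeld1974, §1 Prop. 1.4 (proof)] -/
theorem isDrinfeldCocycle_direction (hA : IsLTRing π q) (hq : 2 ≤ q) {m : ℕ} (hm : 2 ≤ m)
    {N : Type v} [AddCommGroup N] [Module 𝒪 N] (d : N) :
    IsDrinfeldCocycle m ((-dirCoeff π q hA m) • d) (fun a => actDir π q hA m a • d) := by
  by_cases hpow : IsQPow q m
  · -- `w = π`, `qν = p/π = d_m`, `q(a) = (a^m − a)/π = −e_m(a)`
    obtain ⟨hwp, hd⟩ := dirCoeff_spec_of_isQPow (π := π) hA hpow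
    have hν := lazardNu_eq_of_isQPow (π := π) hA hq hpow
    have he : ∀ a, π * (-actDir π q hA m a) = a ^ m - a := fun a => by
      have := (actDir_spec (π := π) hA m a).1
      rw [if_pos hpow] at this
      rw [mul_neg, this, neg_sub]
    have h := isDrinfeldCocycle_of_div (N := N) (by omega : 0 < m) (w := π) (qν := dirCoeff π q hA m)
      (q := fun a => -actDir π q hA m a) (isRegular_of_isLTRing hA) (by rw [hd, mul_comm, hwp, hν]) he (-d)
    simp only [smul_neg, neg_smul, neg_neg] at h
    rw [neg_smul]
    exact h
  · -- `w = 1`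
    have h := isDrinfeldCocycle_standard (𝒪 := 𝒪) (by omega : 0 < m) (-d : N)
    have hd : dirCoeff π q hA m = lazardNu m := by rw [dirCoeff, if_neg hpow]
    have he : ∀ a, actDir π q hA m a = a - a ^ m := fun a => by
      have := (actDir_spec (π := π) hA m a).1; rwa [if_neg hpow] at this
    simp only [smul_neg] at h
    rw [hd, neg_smul]
    simp only [he]
    convert h using 2 with a
    rw [← neg_smul, neg_sub]

variable [IsDomain 𝒪] [IsDiscreteValuationRing 𝒪]

/-- If `ν(m)` is not a unit of `𝒪` then `m` is a power of the residue characteristic `p`. [cite: Lazard1955, §II Lemme 3] -/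
theorem exists_eq_prime_pow_of_not_isUnit_lazardNu (p : ℕ) [hp : Fact p.Prime] [CharP (ResidueField 𝒪) p] {m : ℕ}
    (hm : 2 ≤ m) (hν : ¬ IsUnit (lazardNu m : 𝒪)) :
    ∃ j : ℕ, 1 ≤ j ∧ m = p ^ j := by
  have hprime : IsPrimePow m := by
    by_contra h
    rw [lazardNu_of_not_isPrimePow h, Nat.cast_one] at hν
    exact hν isUnit_one
  have hmin := hprime.minFac_pow_factorization_eq
  have hℓ : (m.minFac : ResidueField 𝒪) = 0 := by
    have : (lazardNu m : 𝒪) ∈ maximalIdeal 𝒪 := (mem_maximalIdeal _).mpr hν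
    rw [← residue_eq_zero_iff, map_natCast] at this
    rwa [lazardNu, if_pos hprime] at this
  rw [CharP.cast_eq_zero_iff (ResidueField 𝒪) p] at hℓ
  have hℓp : p = m.minFac :=
    (Nat.prime_dvd_prime_iff_eq hp.out (Nat.minFac_prime (by omega))).mp hℓ
  refine ⟨m.factorization m.minFac, ?_, ?_⟩
  · by_contra h0
    have : m.factorization m.minFac = 0 := by omega
    rw [this, pow_zero] at hmin; omega
  · rw [hℓp]; exact hmin.symm

/-- **Drinfeld's key lemma read against the universal law**: for `𝒪` a DVR with finite residue field (uniformizer `ϖ`,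
`q = #k`), every Drinfeld cocycle `(c, δ)` of degree `m ≥ 2` over any `𝒪`-module `N` is `d • (−d_m, e_m)` for some `d ∈ N`,
where `(−d_m, e_m)` is the degree-`m` direction of the variable `S_m` in Hazewinkel's universal law (`dirCoeff`, `actDir`).
Cases: `ν(m)` a unit or some `u^m − u` a unit (★ easy cases, `m ∉ q^ℕ`), and `m = q^i` (★ hard case: subtract the multiple
fixed by `δ ϖ` and apply ★ `IsDrinfeldCocycle.eq_zero_of_apply_eq_zero`). [cite: Drinfeld1974, §1 Prop. 1.4] [cite: Hazewinkel1978, §21.4] -/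
theorem exists_eq_smul_direction (p : ℕ) [hp : Fact p.Prime] [CharP (ResidueField 𝒪) p] [Finite (ResidueField 𝒪)]
    {ϖ : 𝒪} (hϖ : Irreducible ϖ) (hA : IsLTRing ϖ (Nat.card (ResidueField 𝒪)))
    (hq : 2 ≤ Nat.card (ResidueField 𝒪)) {m : ℕ} (hm : 2 ≤ m) {N : Type v} [AddCommGroup N] [Module 𝒪 N]
    {c : N} {δ : 𝒪 → N} (h : IsDrinfeldCocycle m c δ) :
    ∃ d : N, c = (-dirCoeff ϖ (Nat.card (ResidueField 𝒪)) hA m) • d ∧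
      ∀ a, δ a = actDir ϖ (Nat.card (ResidueField 𝒪)) hA m a • d := by
  set q := Nat.card (ResidueField 𝒪) with hqdef
  have hmax : maximalIdeal 𝒪 = Ideal.span {ϖ} := (IsDiscreteValuationRing.irreducible_iff_uniformizer ϖ).1 hϖ
  by_cases hpow : IsQPow q m
  · -- the hard case `m = q^i`
    obtain ⟨hwp, hd⟩ := dirCoeff_spec_of_isQPow (π := ϖ) hA hpow
    have he : ∀ a, ϖ * actDir ϖ q hA m a = a - a ^ m := fun a => by
      have := (actDir_spec (π := ϖ) hA m a).1; rwa [if_pos hpow] at this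
    -- `e_m(ϖ) = 1 − ϖ^{m−1}` is a unit
    have heϖ : actDir ϖ q hA m ϖ = 1 - ϖ ^ (m - 1) := by
      have h1 := he ϖ
      have h2 : ϖ * (1 - ϖ ^ (m - 1)) = ϖ - ϖ ^ m := by
        rw [mul_sub, mul_one, ← pow_succ', Nat.sub_add_cancel (by omega : 1 ≤ m)]
      exact mul_left_cancel₀ hϖ.ne_zero (h1.trans h2.symm)
    have hunit : IsUnit (actDir ϖ q hA m ϖ) := by rw [heϖ]; exact hA.isUnit_one_sub_pow (m - 1) (by omega)
    obtain ⟨υ, hυ⟩ := hunit.exists_left_inv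
    set d : N := υ • δ ϖ with hddef
    -- the remainder after subtracting `d • direction`
    have h0 := isDrinfeldCocycle_direction (π := ϖ) hA hq hm d
    have h1 := h.sub h0
    have hδ₁ϖ : δ ϖ - actDir ϖ q hA m ϖ • d = 0 := by
      rw [hddef, smul_smul]
      show δ ϖ - (actDir ϖ q hA m ϖ * υ) • δ ϖ = 0
      rw [mul_comm, hυ, one_smul, sub_self]
    have hν : (lazardNu m : 𝒪) ∈ maximalIdeal 𝒪 := by
      rw [lazardNu_eq_of_isQPow (π := ϖ) hA hq hpow, hmax]
      exact hA.exists_prime.choose_spec.choose_spec.2.2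
    have hpow' : ∀ u : 𝒪, u ^ m - u ∈ maximalIdeal 𝒪 := fun u => by
      rw [hmax, Ideal.mem_span_singleton, ← dvd_neg, neg_sub, ← he u]
      exact Dvd.intro _ rfl
    obtain ⟨hc, hδ⟩ := h1.eq_zero_of_apply_eq_zero p hmax hm hν hpow' hδ₁ϖ
    exact ⟨d, sub_eq_zero.mp hc, fun a => sub_eq_zero.mp (hδ a)⟩
  · -- the easy cases: `ν(m)` a unit, or `m = p^j ∉ q^ℕ` and some `u^m − u` a unit
    have hd : dirCoeff ϖ q hA m = lazardNu m := by rw [dirCoeff, if_neg hpow]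
    have he : ∀ a, actDir ϖ q hA m a = a - a ^ m := fun a => by
      have := (actDir_spec (π := ϖ) hA m a).1; rwa [if_neg hpow] at this
    have hstd : ∃ d : N, c = (lazardNu m : 𝒪) • d ∧ ∀ a, δ a = (a ^ m - a) • d := by
      by_cases hν : IsUnit (lazardNu m : 𝒪)
      · exact h.exists_eq_standard_of_isUnit_lazardNu hν
      · obtain ⟨j, hj, hmj⟩ := exists_eq_prime_pow_of_not_isUnit_lazardNu p hm hν
        have hnot : ¬ IsQPow (Nat.card (ResidueField 𝒪)) (p ^ j) := by rw [← hmj]; exact hpow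
        obtain ⟨u, hu⟩ := exists_isUnit_pow_sub_of_not_isQPow (𝒪 := 𝒪) p hj hnot
        rw [← hmj] at hu
        exact h.exists_eq_standard_of_isUnit_pow_sub hu
    obtain ⟨d, hc, hδ⟩ := hstd
    refine ⟨-d, ?_, fun a => ?_⟩
    · rw [hc, hd, neg_smul, smul_neg, neg_neg]
    · rw [hδ, he, smul_neg, ← neg_smul, neg_sub]

end Direction

end UnivOModule

end Literature.RingTheory.FormalGroups
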